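import Literature.Combinatorics.Sahi2008.GeneratingFunction
import Summits.CriticalPhenomena.PercolationContinuityZ3.Theorems.PercNearOneGluingNoHeavyLowerTailSahiCubeThreeAllOrders

/-!
# `NoHeavyLowerTail` (crux stmt-CriticalPhenomena-4575), Sahi programme P1: Sahi's Conjectures 4 and 5 for every FKG poset
# with at most three join-irreducibles, every order — Birkhoff transfer and the printed power-series form

Support file (Sahi cell, seat `prim-sahi-p1`, generation 2; `--supports stmt-CriticalPhenomena-4575`).  Corollaries of
`SahiCubeAllOrders.sahiPositive_cube_three` (Sahi's Conjecture 5 on `{0,1}³` for every FKG weight and every `n`):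

* `sahiPositive_of_card_supIrred_le_three` — on ANY finite distributive lattice with at most three join-irreducible
  elements (Lieb–Sahi's "FKG posets" [LiebSahi2021, Conj. 1.1]: e.g. `2^X` for `|X| ≤ 3`, the grids `[2]×[3]`, `[4]`, chains,
  …) every FKG probability weight is Sahi-positive of every order.  Proof: Birkhoff's embedding `a ↦ {j irreducible, j ≤ a}`
  into `2^J` is an injective lattice map with the monotone retraction `S ↦ ⋁ S` (every element is the join of the
  join-irreducibles below it, `exists_supIrred_decomposition`), so the weight pushes forward to an FKG weight on `2^J`
  (`isFKGMeasure_pushWeight`) and positivity descends (`sahiPositive_of_pushWeight_of_retract`).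
* `sahiPositive_of_principalBasis` — the general criterion behind all of this: if every antichain family of `≥ 3` up-sets
  of `L` has at most two non-principal members, every FKG weight on `L` is Sahi-positive of every order (FKG inequality +
  peel + cumulation padding; a purely combinatorial hypothesis on `L`).
* `sahi2008_conj4_card_le_three` — the PRINTED form of [Sahi2008, Conj. 4] for `|X| ≤ 3`: for every FKG weight on `2^X`,
  `|X| ≤ 3`, and every `F = Σ_i f_i t^i ∈ ℐ[X]` (nonnegative increasing coefficients), all coefficients of
  `1 − ∏_S (1 − F(S))^{μ(S)}` are nonnegative (via Lieb–Sahi's Theorem 4.4, tree `forall_sahiPositive_iff_sahiSeries`);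
  Sahi proves `|X| ≤ 2` (Prop. 15, tree `sahi2008_prop15_powerSeries`).
-/

namespace Summit.CriticalPhenomena.PercolationContinuityZ3.Theorems.SahiCubeAllOrders

open Finset Function Literature.Combinatorics.Sahi2008
open scoped BigOperators

/-! ## The principal-basis criterion (any finite distributive lattice) -/

section PrincipalBasis

variable {α : Type*} [DistribLattice α] [Fintype α] [DecidableEq α] [DecidableLE α]

open Literature.Probability.LatticeModels (principalUp)

/-- **Principal-basis criterion.**  Let `μ` be an FKG probability weight on a finite distributive lattice `L`.  If every
antichain family of `k ≥ 3` up-sets of `L` has at most two members that are not principal up-sets `↑c`, then `μ` is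
Sahi-positive of EVERY order (antichain basis `sahiPositive_of_antichainBasis` + cumulation padding
`sahiE_nonneg_of_isLatticeCumulation_offTwo`; the only analytic input is the FKG inequality).  The hypothesis is a finite
combinatorial property of `L` alone; it holds e.g. for the grids `[2]×[k]`, `k ≤ 5`, and fails for `{0,1}³` exactly at the
three triples `T_A, T_B, T_C` of `SahiC3Cube.latticeE3_nonneg_cube_three` (seat enumeration, PROOF-C3.md §12). [this work] -/
theorem sahiPositive_of_principalBasis {μ : α → ℝ} (hμ : IsFKGMeasure μ)
    (H : ∀ (k : ℕ) (U : Fin (k + 3) → Finset α), (∀ i, IsUpperSet ((U i : Finset α) : Set α)) →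
      (Pairwise fun i j => ¬ U j ⊆ U i) → ∃ I : Finset (Fin (k + 3)), I.card ≤ 2 ∧ ∀ i, i ∉ I → ∃ c, U i = principalUp c)
    (n : ℕ) : SahiPositive μ n := by
  refine sahiPositive_of_antichainBasis hμ (fun k U hU hanti => ?_) n
  obtain ⟨I, hI, hprin⟩ := H k U hU hanti
  refine sahiE_nonneg_of_isLatticeCumulation_offTwo hμ _ (fun i x => setInd_nonneg _ _)
    (fun i => monotone_setInd (hU i)) I hI fun i hi => ?_
  obtain ⟨c, hc⟩ := hprin i hi
  rw [hc]
  exact isLatticeCumulation_setInd_principalUp c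

end PrincipalBasis

/-! ## Birkhoff transfer: at most three join-irreducibles -/

section Birkhoff

variable {α : Type*} [DistribLattice α] [Fintype α]

/-- **Birkhoff embedding with a monotone retraction** (packaged existentially, no new definitions): for a nonempty
finite distributive lattice `α` and `J = {j // SupIrred j}`, the map `E a = {j | j ≤ a}` is injective and preserves `⊓`
and `⊔` (join-irreducibles are join-prime), and `R S = ⋁ S` is a monotone left inverse (every element is the join of the
join-irreducibles below it); compare Mathlib's `OrderEmbedding.birkhoffSet` and `exists_supIrred_decomposition`. [this work] -/
theorem exists_birkhoff_embedding_retract [Nonempty α] :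
    ∃ (E : α → Set {j : α // SupIrred j}) (R : Set {j : α // SupIrred j} → α), Function.Injective E ∧
      (∀ a b, E (a ⊓ b) = E a ⊓ E b) ∧ (∀ a b, E (a ⊔ b) = E a ⊔ E b) ∧ Monotone R ∧ ∀ a, R (E a) = a := by
  classical
  letI : OrderBot α := Fintype.toOrderBot α
  obtain ⟨E, hE⟩ : ∃ E : α → Set {j : α // SupIrred j}, ∀ a j, j ∈ E a ↔ (j : α) ≤ a :=
    ⟨fun a => {j | (j : α) ≤ a}, fun a j => Iff.rfl⟩
  obtain ⟨R, hR⟩ : ∃ R : Set {j : α // SupIrred j} → α,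
      ∀ S, R S = (univ.filter fun j => j ∈ S).sup Subtype.val :=
    ⟨fun S => (univ.filter fun j => j ∈ S).sup Subtype.val, fun S => rfl⟩
  have hRE : ∀ a, R (E a) = a := by
    intro a
    rw [hR]
    refine le_antisymm (Finset.sup_le fun j hj => ?_) ?_
    · rw [mem_filter, hE] at hj
      exact hj.2
    · obtain ⟨s, hs, hirr⟩ := exists_supIrred_decomposition a
      conv_lhs => rw [← hs]
      refine Finset.sup_le fun b hb => ?_
      have hba : b ≤ a := by
        rw [← hs]
        exact Finset.le_sup (f := id) hb
      exact Finset.le_sup (f := Subtype.val) (b := ⟨b, hirr hb⟩)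
        (by rw [mem_filter, hE]; exact ⟨mem_univ _, hba⟩)
  refine ⟨E, R, fun a b h => by rw [← hRE a, h, hRE], fun a b => ?_, fun a b => ?_, fun S T hST => ?_, hRE⟩
  · ext j
    show j ∈ E (a ⊓ b) ↔ j ∈ E a ∩ E b
    rw [Set.mem_inter_iff, hE, hE, hE, le_inf_iff]
  · ext j
    show j ∈ E (a ⊔ b) ↔ j ∈ E a ∪ E b
    rw [Set.mem_union, hE, hE, hE]
    exact j.2.supPrime.le_sup
  · rw [hR, hR]
    refine Finset.sup_mono fun j hj => ?_
    rw [mem_filter] at hj ⊢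
    exact ⟨hj.1, hST hj.2⟩

/-- **Sahi's Conjecture 5 on every FKG poset with at most three join-irreducibles, every order.**  If a finite
distributive lattice `α` has at most three join-irreducible elements, then every FKG probability weight on `α` is
Sahi-positive of EVERY order `n` (`E_n(f_1,…,f_n) ≥ 0` for nonnegative monotone `f_i`).  Birkhoff transfer of
`sahiPositive_set_of_card_le_three`. [this work] -/
theorem sahiPositive_of_card_supIrred_le_three [DecidableEq α] (h3 : Nat.card {j : α // SupIrred j} ≤ 3)
    {μ : α → ℝ} (hμ : IsFKGMeasure μ) (n : ℕ) : SahiPositive μ n := by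
  classical
  have hne : Nonempty α := by
    by_contra h
    rw [not_nonempty_iff] at h
    have h0 : ∑ x, μ x = 0 := Fintype.sum_empty _
    have h1 := hμ.sum_eq_one
    rw [h0] at h1
    exact zero_ne_one h1
  obtain ⟨E, R, hEinj, hEinf, hEsup, hRmono, hRE⟩ := exists_birkhoff_embedding_retract (α := α)
  have hcard : Fintype.card {j : α // SupIrred j} ≤ 3 := by
    rwa [← Nat.card_eq_fintype_card]
  have hμ' : IsFKGMeasure (pushWeight μ E) := isFKGMeasure_pushWeight hμ hEinj hEinf hEsup
  exact sahiPositive_of_pushWeight_of_retract hRmono hRE (sahiPositive_set_of_card_le_three hcard hμ' n)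

end Birkhoff

/-! ## The printed power-series form (Sahi's Conjecture 4) for `|X| ≤ 3` -/

section PowerSeries

open PowerSeries

/-- **Sahi 2008, Conjecture 4 for `|X| ≤ 3`** (printed form; Sahi proves `|X| ≤ 2`, Prop. 15, tree
`sahi2008_prop15_powerSeries`): on `2^X` with at most three elements, for every FKG probability weight `μ` and every
`F = Σ_{i ≥ 1} f_i t^i ∈ ℐ[X]` (nonnegative increasing coefficient functions `f_i`), all coefficients of
`1 − ∏_{S ⊆ X} (1 − F(S))^{μ(S)}` are nonnegative.  From `sahiThreePointLattice` by Lieb–Sahi's Theorem 4.4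
(`forall_sahiPositive_iff_sahiSeries`); statement of the conjecture: [Sahi2008, Conj. 4 (p. 212)], the equivalence used:
[LiebSahi2021, Thm. 4.4]. [this work] -/
theorem sahi2008_conj4_card_le_three (X : Type) [Fintype X] (hX : Fintype.card X ≤ 3)
    (μ : Set X → ℝ) (hμ : IsFKGMeasure μ) (f : ℕ → Set X → ℝ) (hf0 : ∀ i ω, 0 ≤ f i ω)
    (hfm : ∀ i, Monotone (f i)) (M : ℕ) : 0 ≤ coeff M (sahiSeries μ f) :=
  (forall_sahiPositive_iff_sahiSeries μ hμ.sum_eq_one).1 (sahiThreePointLattice X hX μ hμ) f hf0 hfm M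

/-- The power-series form on an arbitrary FKG poset with at most three join-irreducibles: all coefficients of Sahi's
series `1 − ∏_x (1 − Σ_i f_i(x) t^i)^{μ(x)}` are nonnegative for nonnegative monotone `f_i` (the form of [LiebSahi2021,
Conj. 1.2], via their Thm. 4.4). [this work] -/
theorem sahiSeries_coeff_nonneg_of_card_supIrred_le_three {α : Type*} [DistribLattice α] [Fintype α] [DecidableEq α]
    (h3 : Nat.card {j : α // SupIrred j} ≤ 3) {μ : α → ℝ} (hμ : IsFKGMeasure μ) (f : ℕ → α → ℝ)
    (hf0 : ∀ i x, 0 ≤ f i x) (hfm : ∀ i, Monotone (f i)) (M : ℕ) : 0 ≤ coeff M (sahiSeries μ f) :=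
  (forall_sahiPositive_iff_sahiSeries μ hμ.sum_eq_one).1 (sahiPositive_of_card_supIrred_le_three h3 hμ) f hf0 hfm M

end PowerSeries

end Summit.CriticalPhenomena.PercolationContinuityZ3.Theorems.SahiCubeAllOrders
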